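import Literature.Analysis.FluidPDE.CompressibleEulerPrimitiveForm
import Literature.Analysis.FunctionSpaces.TorusDiffMonomials
import Literature.Analysis.FunctionSpaces.TorusInverseLaplacianCalculus
import HarnessLib

/-!
# The differentiated primitive Euler system on `𝕋³`: commutators as differential monomials

Analysis/FluidPDE support file (definitions with proved API; no named facts). Step three of the
a-priori `H^m` estimates behind the continuation principle for the non-isentropic compressible
Euler equations with the monatomic law `p = ρϑζ(ρ)`, `e = 3ϑ/2` (Majda 1984, Ch. 2 §2.1,
Thm 2.2; Dafermos 2005, Thm 5.1.1): applying `∂^w = ∂_{w₁}⋯∂_{w_n}` to the primitive system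

  `∂ₜρ + u·∇ρ + ρ div u = 0`,
  `∂ₜu_k + u·∇u_k + A(ρ,ϑ) ∂ₖρ + ζ(ρ) ∂ₖϑ = 0`    (`A = p_ρ/ρ = ϑ(ζ + ρζ')/ρ`),
  `∂ₜϑ + u·∇ϑ + D(ρ,ϑ) div u = 0`                   (`D = 2ϑζ(ρ)/3`)

(`IsPrimitiveEulerSolutionOn (monatomicExcess ζ f)`, `CompressibleEulerPrimitiveForm`) gives the
same system for `(ρ_w, u_w, ϑ_w) = (∂^wρ, ∂^wu, ∂^wϑ)` with right-hand sides — the COMMUTATORS —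
which are finite sums of proper differential monomials (`Torus.DiffMonomial`,
`TorusDiffMonomials`) in the five scalar unknowns `ρ, ϑ, u₁, u₂, u₃` with coefficients smooth
functions of `(ρ, ϑ)` on the quadrant `ρ, ϑ > 0`. This file defines these sums SYMBOLICALLY by
the recursion in the word (`FF`, `GG`, `HH`: differentiate the previous right-hand side with the
symbolic Leibniz/chain rule `DiffMonomial.dExp`, and subtract the new commutator terms
`(∂ⱼuᵢ)∂ᵢρ_w + (∂ⱼρ) div u_w`, resp. `(∂ⱼuᵢ)∂ᵢu_{k,w} + ∂ⱼ[A] ∂ₖρ_w + ∂ⱼ[ζ] ∂ₖϑ_w`, resp.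
`(∂ⱼuᵢ)∂ᵢϑ_w + ∂ⱼ[D] div u_w`), records their SHAPE (`mem_FF`/`mem_GG`/`mem_HH`: for `|w| = n`
every monomial is proper, of width `2 ≤ r ≤ n + 1`, order `n + 1`, maximal factor order `≤ n`,
with coefficient smooth on the quadrant — exactly the hypotheses of the per-term bound
`DiffMonomial.sqrt_integral_eval_sq_le` of `TorusDiffMonomialBounds`), and PROVES that they are
the right-hand sides of the differentiated system along any primitive solution on a closed time
interval (`continuity_word`, `momentum_word`, `temperature_word`; time and space derivatives
commute by `Torus.timeDerivWithin_partialDeriv_comm`, space derivatives by `Torus.partialDeriv_comm`).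

## References

* A. Majda, *Compressible Fluid Flow and Systems of Conservation Laws in Several Space
  Variables*, Springer 1984, Ch. 2 §2.1, proof of Thm 2.2 (and Thm 2.1 (2.8a–c)). [Majda1984]
* C. M. Dafermos, *Hyperbolic Conservation Laws in Continuum Physics*, 2nd ed., Springer 2005,
  §5.1, Thm 5.1.1, (5.1.20)–(5.1.25). [Dafermos2005]
-/

noncomputable section

open Set Function MeasureTheory
open scoped ContDiff

namespace Literature.Analysis.FluidPDE

namespace CompressibleEuler

open Literature.Analysis.FunctionSpaces Literature.Analysis.FunctionSpaces.Torus
open Literature.Analysis.FunctionSpaces.Torus.DiffMonomial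

/-- Notation for the flat 3-torus. -/
local notation "𝕋³" => UnitAddTorus (Fin 3)
/-- Notation for Euclidean 3-space. -/
local notation "ℝ³" => EuclideanSpace ℝ (Fin 3)

/-! ### The five scalar unknowns and the coefficients -/

/-- Index of the five scalar primitive unknowns: `none ↦ ρ`, `some none ↦ ϑ`,
`some (some k) ↦ u_k`. [cite: Majda1984, Ch. 2 §2.1] -/
abbrev PIdx : Type := Option (Option (Fin 3))

/-- The density index. [folklore] -/
abbrev PIdx.rho : PIdx := none

/-- The temperature index. [folklore] -/
abbrev PIdx.theta : PIdx := some none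

/-- The index of the `k`-th velocity component. [folklore] -/
abbrev PIdx.vel (k : Fin 3) : PIdx := some (some k)

/-- The five scalar unknowns at time `t`, as a family indexed by `PIdx`. [cite: Majda1984, Ch. 2 §2.1] -/
def primFields (ρ : ℝ → 𝕋³ → ℝ) (u : ℝ → 𝕋³ → ℝ³) (ϑ : ℝ → 𝕋³ → ℝ) (t : ℝ) : PIdx → 𝕋³ → ℝ
  | none => ρ t
  | some none => ϑ t
  | some (some k) => fun x => u t x k

/-- `primFields` at the density index. [folklore] -/
@[simp] theorem primFields_rho (ρ : ℝ → 𝕋³ → ℝ) (u : ℝ → 𝕋³ → ℝ³) (ϑ : ℝ → 𝕋³ → ℝ) (t : ℝ) :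
    primFields ρ u ϑ t PIdx.rho = ρ t := rfl

/-- `primFields` at the temperature index. [folklore] -/
@[simp] theorem primFields_theta (ρ : ℝ → 𝕋³ → ℝ) (u : ℝ → 𝕋³ → ℝ³) (ϑ : ℝ → 𝕋³ → ℝ) (t : ℝ) :
    primFields ρ u ϑ t PIdx.theta = ϑ t := rfl

/-- `primFields` at a velocity index. [folklore] -/
@[simp] theorem primFields_vel (ρ : ℝ → 𝕋³ → ℝ) (u : ℝ → 𝕋³ → ℝ³) (ϑ : ℝ → 𝕋³ → ℝ) (t : ℝ)
    (k : Fin 3) : primFields ρ u ϑ t (PIdx.vel k) = fun x => u t x k := rfl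

/-- The coefficient `A(ρ,ϑ) = p_ρ/ρ = ϑ(ζ(ρ) + ρζ'(ρ))/ρ` of `∇ρ` in the velocity equation.
[cite: Majda1984, Ch. 2 §2.1 (2.8b)] -/
def Acoef (ζ : ℝ → ℝ) (r θ : ℝ) : ℝ := θ * (ζ r + r * deriv ζ r) / r

/-- The coefficient `ζ(ρ) = p_ϑ/ρ` of `∇ϑ` in the velocity equation, as a function of `(ρ,ϑ)`.
[cite: Majda1984, Ch. 2 §2.1 (2.8b)] -/
def Zcoef (ζ : ℝ → ℝ) (r _θ : ℝ) : ℝ := ζ r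

/-- The coefficient `D(ρ,ϑ) = 2ϑζ(ρ)/3` of `div u` in the temperature equation.
[cite: Majda1984, Ch. 2 §2.1 (2.8c)] -/
def Dcoef (ζ : ℝ → ℝ) (r θ : ℝ) : ℝ := 2 / 3 * (θ * ζ r)

/-- The open quadrant `{ρ > 0, ϑ > 0}`. [folklore] -/
abbrev quadrant : Set (ℝ × ℝ) := Ioi 0 ×ˢ Ioi 0

section CoeffSmooth

variable {ζ : ℝ → ℝ}

/-- `A` is smooth on the quadrant. [folklore] -/
theorem contDiffOn_Acoef (hζ : ContDiff ℝ ∞ ζ) : ContDiffOn ℝ ∞ (uncurry (Acoef ζ)) quadrant := by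
  have hζ' : ContDiff ℝ ∞ (deriv ζ) := (contDiff_infty_iff_deriv.1 hζ).2
  have h1 : ContDiff ℝ ∞ fun q : ℝ × ℝ => q.2 * (ζ q.1 + q.1 * deriv ζ q.1) :=
    contDiff_snd.mul ((hζ.comp contDiff_fst).add (contDiff_fst.mul (hζ'.comp contDiff_fst)))
  have h : uncurry (Acoef ζ) = fun q : ℝ × ℝ => q.2 * (ζ q.1 + q.1 * deriv ζ q.1) / q.1 := by
    funext ⟨r, θ⟩; rfl
  rw [h]
  exact h1.contDiffOn.div contDiffOn_fst fun q hq => (mem_prod.1 hq).1.ne'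

/-- `ζ` (as a function of `(ρ,ϑ)`) is smooth on the quadrant. [folklore] -/
theorem contDiffOn_Zcoef (hζ : ContDiff ℝ ∞ ζ) : ContDiffOn ℝ ∞ (uncurry (Zcoef ζ)) quadrant := by
  have h : uncurry (Zcoef ζ) = fun q : ℝ × ℝ => ζ q.1 := by funext ⟨r, θ⟩; rfl
  rw [h]; exact (hζ.comp contDiff_fst).contDiffOn

/-- `D` is smooth on the quadrant. [folklore] -/
theorem contDiffOn_Dcoef (hζ : ContDiff ℝ ∞ ζ) : ContDiffOn ℝ ∞ (uncurry (Dcoef ζ)) quadrant := by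
  have h : uncurry (Dcoef ζ) = fun q : ℝ × ℝ => 2 / 3 * (q.2 * ζ q.1) := by funext ⟨r, θ⟩; rfl
  rw [h]; exact (contDiff_const.mul (contDiff_snd.mul (hζ.comp contDiff_fst))).contDiffOn

/-- Constant coefficients are smooth. [folklore] -/
theorem contDiffOn_uncurry_const (c : ℝ) (U : Set (ℝ × ℝ)) :
    ContDiffOn ℝ ∞ (uncurry fun _ _ : ℝ => c) U := by
  have h : (uncurry fun _ _ : ℝ => c) = fun _ => c := by funext ⟨r, θ⟩; rfl
  rw [h]; exact contDiffOn_const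

/-- Negated coefficients smooth where the coefficient is. [folklore] -/
theorem contDiffOn_uncurry_neg {g : ℝ → ℝ → ℝ} {U : Set (ℝ × ℝ)} (hg : ContDiffOn ℝ ∞ (uncurry g) U) :
    ContDiffOn ℝ ∞ (uncurry fun r θ => -g r θ) U := by
  have h : (uncurry fun r θ => -g r θ) = fun q => -uncurry g q := by funext ⟨r, θ⟩; rfl
  rw [h]; exact hg.neg

end CoeffSmooth

/-! ### The symbolic commutators -/

/-- **Commutator of the continuity equation**: `FF w` is the list of monomials with
`∂ₜρ_w + u·∇ρ_w + ρ div u_w = Σ_{T ∈ FF w} T` (`continuity_word`); recursion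
`FF (j :: w) = ∂ⱼ[FF w] - Σᵢ (∂ⱼuᵢ)(∂ᵢρ_w) - Σₖ (∂ⱼρ)(∂ₖu_{k,w})`.
[cite: Majda1984, Ch. 2 §2.1 Thm 2.2] -/
def FF : List (Fin 3) → List (DiffMonomial (Fin 3) PIdx)
  | [] => []
  | j :: w => (FF w).flatMap (dExp PIdx.rho PIdx.theta j) ++
      (List.ofFn fun i : Fin 3 =>
        (⟨fun _ _ => -1, [([j], PIdx.vel i), (i :: w, PIdx.rho)]⟩ : DiffMonomial (Fin 3) PIdx)) ++
      (List.ofFn fun k : Fin 3 =>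
        (⟨fun _ _ => -1, [([j], PIdx.rho), (k :: w, PIdx.vel k)]⟩ : DiffMonomial (Fin 3) PIdx))

/-- **Commutator of the `k`-th velocity equation**: `GG ζ k w` is the list of monomials with
`∂ₜu_{k,w} + u·∇u_{k,w} + A ∂ₖρ_w + ζ ∂ₖϑ_w = Σ_{T ∈ GG ζ k w} T` (`momentum_word`); recursion
`GG (j :: w) = ∂ⱼ[GG w] - Σᵢ (∂ⱼuᵢ)(∂ᵢu_{k,w}) - (A_ρ∂ⱼρ + A_ϑ∂ⱼϑ) ∂ₖρ_w - (ζ'∂ⱼρ + 0·∂ⱼϑ) ∂ₖϑ_w`.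
[cite: Majda1984, Ch. 2 §2.1 Thm 2.2] -/
def GG (ζ : ℝ → ℝ) (k : Fin 3) : List (Fin 3) → List (DiffMonomial (Fin 3) PIdx)
  | [] => []
  | j :: w => (GG ζ k w).flatMap (dExp PIdx.rho PIdx.theta j) ++
      (List.ofFn fun i : Fin 3 =>
        (⟨fun _ _ => -1, [([j], PIdx.vel i), (i :: w, PIdx.vel k)]⟩ : DiffMonomial (Fin 3) PIdx)) ++
      [⟨fun r θ => -dR (Acoef ζ) r θ, [([j], PIdx.rho), (k :: w, PIdx.rho)]⟩,
        ⟨fun r θ => -dT (Acoef ζ) r θ, [([j], PIdx.theta), (k :: w, PIdx.rho)]⟩,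
        ⟨fun r θ => -dR (Zcoef ζ) r θ, [([j], PIdx.rho), (k :: w, PIdx.theta)]⟩,
        ⟨fun r θ => -dT (Zcoef ζ) r θ, [([j], PIdx.theta), (k :: w, PIdx.theta)]⟩]

/-- **Commutator of the temperature equation**: `HH ζ w` is the list of monomials with
`∂ₜϑ_w + u·∇ϑ_w + D div u_w = Σ_{T ∈ HH ζ w} T` (`temperature_word`); recursion
`HH (j :: w) = ∂ⱼ[HH w] - Σᵢ (∂ⱼuᵢ)(∂ᵢϑ_w) - Σₖ (D_ρ∂ⱼρ + D_ϑ∂ⱼϑ) ∂ₖu_{k,w}`.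
[cite: Majda1984, Ch. 2 §2.1 Thm 2.2] -/
def HH (ζ : ℝ → ℝ) : List (Fin 3) → List (DiffMonomial (Fin 3) PIdx)
  | [] => []
  | j :: w => (HH ζ w).flatMap (dExp PIdx.rho PIdx.theta j) ++
      (List.ofFn fun i : Fin 3 =>
        (⟨fun _ _ => -1, [([j], PIdx.vel i), (i :: w, PIdx.theta)]⟩ : DiffMonomial (Fin 3) PIdx)) ++
      (List.ofFn fun k : Fin 3 =>
        (⟨fun r θ => -dR (Dcoef ζ) r θ, [([j], PIdx.rho), (k :: w, PIdx.vel k)]⟩ : DiffMonomial (Fin 3) PIdx)) ++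
      (List.ofFn fun k : Fin 3 =>
        (⟨fun r θ => -dT (Dcoef ζ) r θ, [([j], PIdx.theta), (k :: w, PIdx.vel k)]⟩ : DiffMonomial (Fin 3) PIdx))

/-! ### Shape of the commutators -/

section Shape

variable {ζ : ℝ → ℝ}

/-- The shape of the explicit width-two monomials `g · ∂ⱼφ · ∂^v φ'` with `|v| = n + 1`: proper,
width `2`, order `n + 2`, maximal factor order `n + 1`. [folklore] -/
theorem shape_two (g : ℝ → ℝ → ℝ) (hg : ContDiffOn ℝ ∞ (uncurry g) quadrant)
    (j : Fin 3) (k₁ k₂ : PIdx) (v : List (Fin 3)) (n : ℕ) (hv : v.length = n + 1) :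
    let T : DiffMonomial (Fin 3) PIdx := ⟨g, [([j], k₁), (v, k₂)]⟩
    T.Proper ∧ 2 ≤ T.width ∧ T.width ≤ (n + 1) + 1 ∧ T.order = (n + 1) + 1 ∧ T.maxOrder ≤ n + 1 ∧
      ContDiffOn ℝ ∞ (uncurry T.coeff) quadrant := by
  intro T
  refine ⟨?_, le_rfl, by simp [T, width], by simp [T, order, hv]; ring, ?_, hg⟩
  · intro f hf
    simp only [T, List.mem_cons, List.mem_nil_iff, or_false] at hf
    rcases hf with rfl | rfl
    · simp
    · intro h
      have : v = [] := h
      rw [this] at hv; simp at hv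
  · simp [T, maxOrder, hv]

/-- The shape of the flat-mapped (differentiated) part of the recursions. [folklore] -/
theorem shape_flatMap {L : List (DiffMonomial (Fin 3) PIdx)} {n : ℕ} (j : Fin 3)
    (hL : ∀ T ∈ L, T.Proper ∧ 2 ≤ T.width ∧ T.width ≤ n + 1 ∧ T.order = n + 1 ∧ T.maxOrder ≤ n ∧
      ContDiffOn ℝ ∞ (uncurry T.coeff) quadrant)
    {T : DiffMonomial (Fin 3) PIdx} (hT : T ∈ L.flatMap (dExp PIdx.rho PIdx.theta j)) :
    T.Proper ∧ 2 ≤ T.width ∧ T.width ≤ (n + 1) + 1 ∧ T.order = (n + 1) + 1 ∧ T.maxOrder ≤ n + 1 ∧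
      ContDiffOn ℝ ∞ (uncurry T.coeff) quadrant := by
  obtain ⟨T₀, hT₀, hT⟩ := List.mem_flatMap.1 hT
  obtain ⟨hp, hw2, hwn, ho, hm, hc⟩ := hL T₀ hT₀
  obtain ⟨ho', hw', hp', hm'⟩ := mem_dExp hT
  refine ⟨hp' hp, ?_, ?_, by rw [ho', ho], hm'.trans (by omega),
    contDiffOn_coeff_of_mem_dExp isOpen_quadrant hc hT⟩
  · rcases hw' with h | h <;> omega
  · rcases hw' with h | h <;> omega

/-- **Shape of `FF w`.** [cite: Majda1984, Ch. 2 §2.1 Thm 2.2] -/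
theorem mem_FF : ∀ (w : List (Fin 3)) {T : DiffMonomial (Fin 3) PIdx}, T ∈ FF w →
    T.Proper ∧ 2 ≤ T.width ∧ T.width ≤ w.length + 1 ∧ T.order = w.length + 1 ∧
      T.maxOrder ≤ w.length ∧ ContDiffOn ℝ ∞ (uncurry T.coeff) quadrant
  | [], T, h => by simp [FF] at h
  | j :: w, T, h => by
    simp only [FF, List.mem_append, List.mem_ofFn] at h
    simp only [List.length_cons]
    rcases h with (h | ⟨i, rfl⟩) | ⟨k, rfl⟩
    · exact shape_flatMap j (fun T hT => mem_FF w hT) h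
    · exact shape_two _ (contDiffOn_uncurry_const _ _) j _ _ _ _ (by simp)
    · exact shape_two _ (contDiffOn_uncurry_const _ _) j _ _ _ _ (by simp)

/-- **Shape of `GG ζ k w`.** [cite: Majda1984, Ch. 2 §2.1 Thm 2.2] -/
theorem mem_GG (hζ : ContDiff ℝ ∞ ζ) (k : Fin 3) : ∀ (w : List (Fin 3)) {T : DiffMonomial (Fin 3) PIdx},
    T ∈ GG ζ k w → T.Proper ∧ 2 ≤ T.width ∧ T.width ≤ w.length + 1 ∧ T.order = w.length + 1 ∧
      T.maxOrder ≤ w.length ∧ ContDiffOn ℝ ∞ (uncurry T.coeff) quadrant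
  | [], T, h => by simp [GG] at h
  | j :: w, T, h => by
    simp only [GG, List.mem_append, List.mem_ofFn, List.mem_cons, List.mem_nil_iff, or_false] at h
    simp only [List.length_cons]
    rcases h with (h | ⟨i, rfl⟩) | rfl | rfl | rfl | rfl
    · exact shape_flatMap j (fun T hT => mem_GG hζ k w hT) h
    · exact shape_two _ (contDiffOn_uncurry_const _ _) j _ _ _ _ (by simp)
    · exact shape_two _ (contDiffOn_uncurry_neg (contDiffOn_dR (contDiffOn_Acoef hζ) isOpen_quadrant))
        j _ _ _ _ (by simp)
    · exact shape_two _ (contDiffOn_uncurry_neg (contDiffOn_dT (contDiffOn_Acoef hζ) isOpen_quadrant))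
        j _ _ _ _ (by simp)
    · exact shape_two _ (contDiffOn_uncurry_neg (contDiffOn_dR (contDiffOn_Zcoef hζ) isOpen_quadrant))
        j _ _ _ _ (by simp)
    · exact shape_two _ (contDiffOn_uncurry_neg (contDiffOn_dT (contDiffOn_Zcoef hζ) isOpen_quadrant))
        j _ _ _ _ (by simp)

/-- **Shape of `HH ζ w`.** [cite: Majda1984, Ch. 2 §2.1 Thm 2.2] -/
theorem mem_HH (hζ : ContDiff ℝ ∞ ζ) : ∀ (w : List (Fin 3)) {T : DiffMonomial (Fin 3) PIdx},
    T ∈ HH ζ w → T.Proper ∧ 2 ≤ T.width ∧ T.width ≤ w.length + 1 ∧ T.order = w.length + 1 ∧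
      T.maxOrder ≤ w.length ∧ ContDiffOn ℝ ∞ (uncurry T.coeff) quadrant
  | [], T, h => by simp [HH] at h
  | j :: w, T, h => by
    simp only [HH, List.mem_append, List.mem_ofFn] at h
    simp only [List.length_cons]
    rcases h with ((h | ⟨i, rfl⟩) | ⟨k, rfl⟩) | ⟨k, rfl⟩
    · exact shape_flatMap j (fun T hT => mem_HH hζ w hT) h
    · exact shape_two _ (contDiffOn_uncurry_const _ _) j _ _ _ _ (by simp)
    · exact shape_two _ (contDiffOn_uncurry_neg (contDiffOn_dR (contDiffOn_Dcoef hζ) isOpen_quadrant))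
        j _ _ _ _ (by simp)
    · exact shape_two _ (contDiffOn_uncurry_neg (contDiffOn_dT (contDiffOn_Dcoef hζ) isOpen_quadrant))
        j _ _ _ _ (by simp)

end Shape

/-! ### The differentiated system: identification of the commutators -/

section Identification

variable {ζ f : ℝ → ℝ} {a b : ℝ} {ρ ϑ : ℝ → 𝕋³ → ℝ} {u : ℝ → 𝕋³ → ℝ³}

/-- Evaluation of a width-two monomial `g · ∂ⱼφ_{k₁} · ∂^v φ_{k₂}`. [folklore] -/
theorem eval_two (φ : PIdx → 𝕋³ → ℝ) (g : ℝ → ℝ → ℝ) (j : Fin 3) (k₁ k₂ : PIdx) (v : List (Fin 3))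
    (x : 𝕋³) :
    DiffMonomial.eval φ PIdx.rho PIdx.theta ⟨g, [([j], k₁), (v, k₂)]⟩ x =
      g (φ PIdx.rho x) (φ PIdx.theta x) * (partialDeriv j (φ k₁) x * iterPartialDeriv v (φ k₂) x) := by
  simp [eval_def]

/-- The fields `primFields ρ u ϑ t` of a primitive solution are smooth at every time of `S`.
[folklore] -/
theorem isSmooth_primFields {eos : EulerEOS} {S : Set ℝ} (h : IsPrimitiveEulerSolutionOn eos S ρ u ϑ)
    {t : ℝ} (ht : t ∈ S) : ∀ k : PIdx, IsSmooth (primFields ρ u ϑ t k)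
  | none => h.smooth_density.isSmooth_slice ht
  | some none => h.smooth_temperature.isSmooth_slice ht
  | some (some k) => (h.smooth_velocity.apply k).isSmooth_slice ht

/-- The state of a primitive solution lies in the quadrant. [folklore] -/
theorem primFields_mem_quadrant {eos : EulerEOS} {S : Set ℝ} (h : IsPrimitiveEulerSolutionOn eos S ρ u ϑ)
    {t : ℝ} (ht : t ∈ S) (x : 𝕋³) :
    (primFields ρ u ϑ t PIdx.rho x, primFields ρ u ϑ t PIdx.theta x) ∈ quadrant :=
  ⟨h.density_pos t ht x, h.temperature_pos t ht x⟩

/-- **The generic differentiation step.** If `∂ₜY + Σᵢ uᵢ∂ᵢY + Σ_l c_l ∂_{k_l} Z_l = E` at time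
`t` (all fields smooth), then applying `∂ⱼ` and commuting derivatives,
`∂ₜ(∂ⱼY) + Σᵢ uᵢ∂ᵢ(∂ⱼY) + Σ_l c_l ∂_{k_l}(∂ⱼZ_l) = ∂ⱼE - Σᵢ (∂ⱼuᵢ)(∂ᵢY) - Σ_l (∂ⱼc_l)(∂_{k_l}Z_l)`.
[cite: Majda1984, Ch. 2 §2.1 Thm 2.2] -/
theorem word_step {S : Set ℝ} (hS : UniqueDiffOn ℝ S) {t : ℝ} (ht : t ∈ S) (j : Fin 3) (x : 𝕋³)
    {uu : Fin 3 → 𝕋³ → ℝ} (huu : ∀ i, IsSmooth (uu i))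
    {Y : ℝ → 𝕋³ → ℝ} (hY : IsSmoothSpaceTimeOn S Y)
    {n : ℕ} {c : Fin n → 𝕋³ → ℝ} (hc : ∀ l, IsSmooth (c l)) (kk : Fin n → Fin 3)
    {Z : Fin n → 𝕋³ → ℝ} (hZ : ∀ l, IsSmooth (Z l))
    {E dE : 𝕋³ → ℝ} (hE : IsSmooth E) (hdE : ∀ y, partialDeriv j E y = dE y)
    (ih : ∀ y, timeDerivWithin S Y t y + (∑ i, uu i y * partialDeriv i (Y t) y) +
      ∑ l, c l y * partialDeriv (kk l) (Z l) y = E y)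
    (hcomm : timeDerivWithin S (fun s => partialDeriv j (Y s)) t x =
      partialDeriv j (timeDerivWithin S Y t) x) :
    timeDerivWithin S (fun s => partialDeriv j (Y s)) t x +
        (∑ i, uu i x * partialDeriv i (partialDeriv j (Y t)) x) +
        ∑ l, c l x * partialDeriv (kk l) (partialDeriv j (Z l)) x =
      dE x - (∑ i, partialDeriv j (uu i) x * partialDeriv i (Y t) x) -
        ∑ l, partialDeriv j (c l) x * partialDeriv (kk l) (Z l) x := by
  have hYt : IsSmooth (Y t) := hY.isSmooth_slice ht
  have hdY : IsSmooth (timeDerivWithin S Y t) := hY.isSmooth_timeDerivWithin hS ht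
  -- the transport and coupling parts as smooth functions
  have hV : IsSmooth (fun y => ∑ i, uu i y * partialDeriv i (Y t) y) := by
    show ContDiff ℝ ∞ fun y => ∑ i, uu i (Torus.proj y) * partialDeriv i (Y t) (Torus.proj y)
    exact ContDiff.sum fun i _ => ContDiff.mul (huu i) (hYt.partialDeriv i)
  have hW : IsSmooth (fun y => ∑ l, c l y * partialDeriv (kk l) (Z l) y) := by
    show ContDiff ℝ ∞ fun y => ∑ l, c l (Torus.proj y) * partialDeriv (kk l) (Z l) (Torus.proj y)
    exact ContDiff.sum fun l _ => ContDiff.mul (hc l) ((hZ l).partialDeriv (kk l))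
  -- the previous identity solved for `∂ₜY`
  have key : timeDerivWithin S Y t = fun y =>
      (E y - ∑ i, uu i y * partialDeriv i (Y t) y) - ∑ l, c l y * partialDeriv (kk l) (Z l) y := by
    funext y; have := ih y; linarith
  have hEV : IsSmooth (fun y => E y - ∑ i, uu i y * partialDeriv i (Y t) y) := hE.sub hV
  -- `∂ⱼ` of the three parts
  have h1 : partialDeriv j (timeDerivWithin S Y t) x =
      (dE x - partialDeriv j (fun y => ∑ i, uu i y * partialDeriv i (Y t) y) x) -
        partialDeriv j (fun y => ∑ l, c l y * partialDeriv (kk l) (Z l) y) x := by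
    rw [key, partialDeriv_sub_apply (hEV.isContDiff (by simp)) (hW.isContDiff (by simp)),
      partialDeriv_sub_apply (hE.isContDiff (by simp)) (hV.isContDiff (by simp)), hdE]
  have h2 : partialDeriv j (fun y => ∑ i, uu i y * partialDeriv i (Y t) y) x =
      (∑ i, uu i x * partialDeriv j (partialDeriv i (Y t)) x) +
        ∑ i, partialDeriv j (uu i) x * partialDeriv i (Y t) x := by
    have hsm : ∀ i, IsSmooth fun y => uu i y * partialDeriv i (Y t) y := fun i =>
      ContDiff.mul (huu i) (hYt.partialDeriv i)
    rw [partialDeriv_finset_sum _ (fun i _ => (hsm i).isContDiff (by simp)), ← Finset.sum_add_distrib]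
    refine Finset.sum_congr rfl fun i _ => ?_
    exact partialDeriv_mul ((huu i).isContDiff (by simp)) ((hYt.partialDeriv i).isContDiff (by simp)) j x
  have h3 : partialDeriv j (fun y => ∑ l, c l y * partialDeriv (kk l) (Z l) y) x =
      (∑ l, c l x * partialDeriv j (partialDeriv (kk l) (Z l)) x) +
        ∑ l, partialDeriv j (c l) x * partialDeriv (kk l) (Z l) x := by
    have hsm : ∀ l, IsSmooth fun y => c l y * partialDeriv (kk l) (Z l) y := fun l =>
      ContDiff.mul (hc l) ((hZ l).partialDeriv (kk l))
    rw [partialDeriv_finset_sum _ (fun l _ => (hsm l).isContDiff (by simp)), ← Finset.sum_add_distrib]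
    refine Finset.sum_congr rfl fun l _ => ?_
    exact partialDeriv_mul ((hc l).isContDiff (by simp)) (((hZ l).partialDeriv (kk l)).isContDiff (by simp)) j x
  -- commute the space derivatives
  have h4 : (∑ i, uu i x * partialDeriv i (partialDeriv j (Y t)) x) =
      ∑ i, uu i x * partialDeriv j (partialDeriv i (Y t)) x :=
    Finset.sum_congr rfl fun i _ => by rw [partialDeriv_comm hYt i j x]
  have h5 : (∑ l, c l x * partialDeriv (kk l) (partialDeriv j (Z l)) x) =
      ∑ l, c l x * partialDeriv j (partialDeriv (kk l) (Z l)) x :=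
    Finset.sum_congr rfl fun l _ => by rw [partialDeriv_comm (hZ l) (kk l) j x]
  rw [hcomm, h1, h2, h3, h4, h5]
  ring

/-- **The differentiated continuity equation**: along a primitive solution on `[a, b]`,
`∂ₜρ_w + Σᵢ uᵢ∂ᵢρ_w + ρ div u_w = Σ_{T ∈ FF w} T(ρ, ϑ, u)` for every word `w`.
[cite: Majda1984, Ch. 2 §2.1 Thm 2.2] -/
theorem continuity_word (hab : a < b)
    (h : IsPrimitiveEulerSolutionOn (EulerEOS.monatomicExcess ζ f) (Icc a b) ρ u ϑ) :
    ∀ (w : List (Fin 3)) {t : ℝ} (_ : t ∈ Icc a b) (x : 𝕋³),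
      timeDerivWithin (Icc a b) (fun s => iterPartialDeriv w (ρ s)) t x +
          (∑ i, u t x i * partialDeriv i (iterPartialDeriv w (ρ t)) x) +
          ∑ k, ρ t x * partialDeriv k (iterPartialDeriv w (fun y => u t y k)) x =
        ((FF w).map fun T => T.eval (primFields ρ u ϑ t) PIdx.rho PIdx.theta x).sum
  | [], t, ht, x => by
      have := h.continuity t ht x
      simp only [Torus.divergence, Finset.mul_sum] at this
      simpa [FF] using this
  | j :: w, t, ht, x => by
      have hS : UniqueDiffOn ℝ (Icc a b) := uniqueDiffOn_Icc hab
      have hφs : ∀ k, IsSmooth (primFields ρ u ϑ t k) := isSmooth_primFields h ht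
      have hφq := primFields_mem_quadrant h ht
      have hRs : IsSmoothSpaceTimeOn (Icc a b) fun s => iterPartialDeriv w (ρ s) :=
        h.smooth_density.iterPartialDeriv hS w
      have hUs : ∀ k : Fin 3, IsSmooth (iterPartialDeriv w fun y => u t y k) := fun k =>
        ((h.smooth_velocity.apply k).iterPartialDeriv hS w).isSmooth_slice ht
      -- smoothness of the previous right-hand side and its derivative
      have hcoef : ∀ T ∈ FF w, ContDiffOn ℝ ∞ (uncurry T.coeff) quadrant := fun T hT => (mem_FF w hT).2.2.2.2.2
      have hE : IsSmooth fun y => ((FF w).map fun T => T.eval (primFields ρ u ϑ t) PIdx.rho PIdx.theta y).sum :=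
        isSmooth_list_sum _ fun T hT => isSmooth_eval hφs (hcoef T hT) hφq
      have hdE : ∀ y, partialDeriv j
          (fun y => ((FF w).map fun T => T.eval (primFields ρ u ϑ t) PIdx.rho PIdx.theta y).sum) y =
          (((FF w).flatMap (dExp PIdx.rho PIdx.theta j)).map
            fun T => T.eval (primFields ρ u ϑ t) PIdx.rho PIdx.theta y).sum := by
        intro y
        rw [partialDeriv_list_sum _ (fun T hT => isSmooth_eval hφs (hcoef T hT) hφq), List.map_flatMap,
          sum_flatMap_eq]
        congr 1
        exact List.map_congr_left fun T hT => partialDeriv_eval hφs isOpen_quadrant (hcoef T hT) hφq j y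
      have step := word_step hS ht j x (uu := fun i y => u t y i) (fun i => hφs (PIdx.vel i)) hRs
        (c := fun _ y => ρ t y) (fun _ => hφs PIdx.rho) (fun k => k)
        (Z := fun k => iterPartialDeriv w fun y => u t y k) hUs hE hdE
        (fun y => continuity_word hab h w ht y)
        (timeDerivWithin_partialDeriv_comm hab hRs ht j x)
      -- rewrite the conclusion
      simp only [iterPartialDeriv_cons]
      rw [step]
      simp only [FF, List.map_append, List.sum_append, List.map_ofFn, List.sum_ofFn, Function.comp_def,
        eval_two, primFields_rho, primFields_vel, iterPartialDeriv_cons]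
      simp only [neg_one_mul, Finset.sum_neg_distrib]
      ring

/-- `∂p/∂ρ = ϑ(ζ(ρ) + ρζ'(ρ))` for `p = ρϑζ(ρ)`. [folklore] -/
theorem deriv_pressure_rho (hζ : ContDiff ℝ ∞ ζ) (r θ : ℝ) :
    deriv (fun r' => r' * θ * ζ r') r = θ * (ζ r + r * deriv ζ r) := by
  have hd : DifferentiableAt ℝ ζ r := (hζ.differentiable (by simp)).differentiableAt
  have h1 : HasDerivAt (fun r' => r' * θ * ζ r') ((1 * θ) * ζ r + (r * θ) * deriv ζ r) r :=
    (((hasDerivAt_id r).mul_const θ)).mul hd.hasDerivAt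
  rw [h1.deriv]; ring

/-- `∂p/∂ϑ = ρζ(ρ)` for `p = ρϑζ(ρ)`. [folklore] -/
theorem deriv_pressure_theta (r θ : ℝ) : deriv (fun θ' => r * θ' * ζ r) θ = r * ζ r := by
  have h1 : HasDerivAt (fun θ' => r * θ' * ζ r) (r * 1 * ζ r) θ :=
    ((hasDerivAt_id θ).const_mul r).mul_const (ζ r)
  rw [h1.deriv]; ring

/-- The `k`-th component of the velocity equation of a primitive solution with the monatomic law:
`∂ₜu_k + Σᵢ uᵢ∂ᵢu_k + A ∂ₖρ + ζ ∂ₖϑ = 0`. [cite: Majda1984, Ch. 2 §2.1 (2.8b)] -/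
theorem momentum_component (hζ : ContDiff ℝ ∞ ζ) {S : Set ℝ} (hS : UniqueDiffOn ℝ S)
    (h : IsPrimitiveEulerSolutionOn (EulerEOS.monatomicExcess ζ f) S ρ u ϑ) {t : ℝ} (ht : t ∈ S)
    (x : 𝕋³) (k : Fin 3) :
    timeDerivWithin S (fun s y => u s y k) t x + (∑ i, u t x i * partialDeriv i (fun y => u t y k) x) +
      (Acoef ζ (ρ t x) (ϑ t x) * partialDeriv k (ρ t) x + ζ (ρ t x) * partialDeriv k (ϑ t) x) = 0 := by
  have hρ1 : IsContDiff 1 (ρ t) := (h.smooth_density.isSmooth_slice ht).isContDiff (by simp)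
  have hϑ1 : IsContDiff 1 (ϑ t) := (h.smooth_temperature.isSmooth_slice ht).isContDiff (by simp)
  have hu1 : IsContDiff 1 (u t) := (h.smooth_velocity.isSmooth_slice ht).isContDiff (by simp)
  have hρx : 0 < ρ t x := h.density_pos t ht x
  -- the pressure composite and its gradient
  have hg : ContDiffOn ℝ ∞ (uncurry fun r θ : ℝ => r * θ * ζ r) univ := by
    have e : (uncurry fun r θ : ℝ => r * θ * ζ r) = fun q : ℝ × ℝ => q.1 * q.2 * ζ q.1 := by
      funext ⟨r, θ⟩; rfl
    rw [e]
    exact ((contDiff_fst.mul contDiff_snd).mul (hζ.comp contDiff_fst)).contDiffOn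
  have hP1 : IsContDiff 1 (fun y => (EulerEOS.monatomicExcess ζ f).p (ρ t y) (ϑ t y)) := by
    show IsContDiff 1 fun y => ρ t y * ϑ t y * ζ (ρ t y)
    exact isContDiff_comp₂ hg (by simp) hρ1 hϑ1 fun _ => mem_univ _
  have hgrad : Torus.gradient (fun y => (EulerEOS.monatomicExcess ζ f).p (ρ t y) (ϑ t y)) x k =
      ϑ t x * (ζ (ρ t x) + ρ t x * deriv ζ (ρ t x)) * partialDeriv k (ρ t) x +
        ρ t x * ζ (ρ t x) * partialDeriv k (ϑ t) x := by
    rw [gradient_apply hP1]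
    show partialDeriv k (fun y => ρ t y * ϑ t y * ζ (ρ t y)) x = _
    rw [partialDeriv_comp₂ hg isOpen_univ (by simp) hρ1 hϑ1 x (mem_univ _) k,
      deriv_pressure_rho hζ, deriv_pressure_theta]
  have he := congrArg (fun v : ℝ³ => v k) (h.euler t ht x)
  simp only [WithLp.ofLp_add, WithLp.ofLp_smul, WithLp.ofLp_sum, WithLp.ofLp_zero, Pi.add_apply,
    Pi.smul_apply, Finset.sum_apply, Pi.zero_apply, smul_eq_mul] at he
  rw [← timeDerivWithin_apply_coord h.smooth_velocity hS ht x k, hgrad] at he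
  have hpd : ∀ i, partialDeriv i (u t) x k = partialDeriv i (fun y => u t y k) x := fun i =>
    (partialDeriv_apply_coord hu1 i x k).symm
  simp only [hpd] at he
  have hA : (ρ t x)⁻¹ * (ϑ t x * (ζ (ρ t x) + ρ t x * deriv ζ (ρ t x)) * partialDeriv k (ρ t) x +
      ρ t x * ζ (ρ t x) * partialDeriv k (ϑ t) x) =
      Acoef ζ (ρ t x) (ϑ t x) * partialDeriv k (ρ t) x + ζ (ρ t x) * partialDeriv k (ϑ t) x := by
    simp only [Acoef]
    field_simp
  rw [hA] at he
  exact he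

/-- **The differentiated velocity equation**: along a primitive solution on `[a, b]`,
`∂ₜu_{k,w} + Σᵢ uᵢ∂ᵢu_{k,w} + A ∂ₖρ_w + ζ ∂ₖϑ_w = Σ_{T ∈ GG ζ k w} T(ρ, ϑ, u)` for every word `w`.
[cite: Majda1984, Ch. 2 §2.1 Thm 2.2] -/
theorem momentum_word (hζ : ContDiff ℝ ∞ ζ) (hab : a < b)
    (h : IsPrimitiveEulerSolutionOn (EulerEOS.monatomicExcess ζ f) (Icc a b) ρ u ϑ) (k : Fin 3) :
    ∀ (w : List (Fin 3)) {t : ℝ} (_ : t ∈ Icc a b) (x : 𝕋³),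
      timeDerivWithin (Icc a b) (fun s => iterPartialDeriv w (fun y => u s y k)) t x +
          (∑ i, u t x i * partialDeriv i (iterPartialDeriv w (fun y => u t y k)) x) +
          (Acoef ζ (ρ t x) (ϑ t x) * partialDeriv k (iterPartialDeriv w (ρ t)) x +
            ζ (ρ t x) * partialDeriv k (iterPartialDeriv w (ϑ t)) x) =
        ((GG ζ k w).map fun T => T.eval (primFields ρ u ϑ t) PIdx.rho PIdx.theta x).sum
  | [], t, ht, x => by
      have := momentum_component hζ (uniqueDiffOn_Icc hab) h ht x k
      simpa [GG] using this
  | j :: w, t, ht, x => by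
      have hS : UniqueDiffOn ℝ (Icc a b) := uniqueDiffOn_Icc hab
      have hφs : ∀ k, IsSmooth (primFields ρ u ϑ t k) := isSmooth_primFields h ht
      have hφq := primFields_mem_quadrant h ht
      have hρ1 : IsContDiff 1 (ρ t) := (hφs PIdx.rho).isContDiff (by simp)
      have hϑ1 : IsContDiff 1 (ϑ t) := (hφs PIdx.theta).isContDiff (by simp)
      have hYs : IsSmoothSpaceTimeOn (Icc a b) fun s => iterPartialDeriv w (fun y => u s y k) :=
        (h.smooth_velocity.apply k).iterPartialDeriv hS w
      have hR : IsSmooth (iterPartialDeriv w (ρ t)) := (hφs PIdx.rho).iterPartialDeriv w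
      have hΘ : IsSmooth (iterPartialDeriv w (ϑ t)) := (hφs PIdx.theta).iterPartialDeriv w
      have hcA : IsSmooth fun y => Acoef ζ (ρ t y) (ϑ t y) :=
        isSmooth_coeffField (a := PIdx.rho) (b := PIdx.theta) hφs (contDiffOn_Acoef hζ) hφq
      have hcZ : IsSmooth fun y => Zcoef ζ (ρ t y) (ϑ t y) :=
        isSmooth_coeffField (a := PIdx.rho) (b := PIdx.theta) hφs (contDiffOn_Zcoef hζ) hφq
      have hcoef : ∀ T ∈ GG ζ k w, ContDiffOn ℝ ∞ (uncurry T.coeff) quadrant := fun T hT =>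
        (mem_GG hζ k w hT).2.2.2.2.2
      have hE : IsSmooth fun y => ((GG ζ k w).map fun T => T.eval (primFields ρ u ϑ t) PIdx.rho PIdx.theta y).sum :=
        isSmooth_list_sum _ fun T hT => isSmooth_eval hφs (hcoef T hT) hφq
      have hdE : ∀ y, partialDeriv j
          (fun y => ((GG ζ k w).map fun T => T.eval (primFields ρ u ϑ t) PIdx.rho PIdx.theta y).sum) y =
          (((GG ζ k w).flatMap (dExp PIdx.rho PIdx.theta j)).map
            fun T => T.eval (primFields ρ u ϑ t) PIdx.rho PIdx.theta y).sum := by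
        intro y
        rw [partialDeriv_list_sum _ (fun T hT => isSmooth_eval hφs (hcoef T hT) hφq), List.map_flatMap,
          sum_flatMap_eq]
        congr 1
        exact List.map_congr_left fun T hT => partialDeriv_eval hφs isOpen_quadrant (hcoef T hT) hφq j y
      -- the two coupling terms as a `Fin 2`-family
      have hc2 : ∀ l : Fin 2, IsSmooth (![fun y => Acoef ζ (ρ t y) (ϑ t y), fun y => Zcoef ζ (ρ t y) (ϑ t y)] l) :=
        Fin.forall_fin_two.2 ⟨hcA, hcZ⟩
      have hZ2 : ∀ l : Fin 2, IsSmooth (![iterPartialDeriv w (ρ t), iterPartialDeriv w (ϑ t)] l) :=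
        Fin.forall_fin_two.2 ⟨hR, hΘ⟩
      have ih2 : ∀ y, timeDerivWithin (Icc a b) (fun s => iterPartialDeriv w (fun y => u s y k)) t y +
          (∑ i, u t y i * partialDeriv i (iterPartialDeriv w (fun y => u t y k)) y) +
          ∑ l : Fin 2, (![fun y => Acoef ζ (ρ t y) (ϑ t y), fun y => Zcoef ζ (ρ t y) (ϑ t y)] l) y *
            partialDeriv k (![iterPartialDeriv w (ρ t), iterPartialDeriv w (ϑ t)] l) y =
          ((GG ζ k w).map fun T => T.eval (primFields ρ u ϑ t) PIdx.rho PIdx.theta y).sum := by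
        intro y
        have := momentum_word hζ hab h k w ht y
        simp only [Fin.sum_univ_two, Matrix.cons_val_zero, Matrix.cons_val_one, Zcoef]
        simpa [Zcoef] using this
      have step := word_step hS ht j x (uu := fun i y => u t y i) (fun i => hφs (PIdx.vel i)) hYs
        hc2 (fun _ => k) hZ2 hE hdE ih2 (timeDerivWithin_partialDeriv_comm hab hYs ht j x)
      simp only [Fin.sum_univ_two, Matrix.cons_val_zero, Matrix.cons_val_one] at step
      -- the derivatives of the coefficient composites
      have hdA : partialDeriv j (fun y => Acoef ζ (ρ t y) (ϑ t y)) x =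
          dR (Acoef ζ) (ρ t x) (ϑ t x) * partialDeriv j (ρ t) x +
            dT (Acoef ζ) (ρ t x) (ϑ t x) * partialDeriv j (ϑ t) x :=
        partialDeriv_comp₂ (contDiffOn_Acoef hζ) isOpen_quadrant (by simp) hρ1 hϑ1 x (hφq x) j
      have hdZ : partialDeriv j (fun y => Zcoef ζ (ρ t y) (ϑ t y)) x =
          dR (Zcoef ζ) (ρ t x) (ϑ t x) * partialDeriv j (ρ t) x +
            dT (Zcoef ζ) (ρ t x) (ϑ t x) * partialDeriv j (ϑ t) x :=
        partialDeriv_comp₂ (contDiffOn_Zcoef hζ) isOpen_quadrant (by simp) hρ1 hϑ1 x (hφq x) j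
      rw [hdA, hdZ] at step
      simp only [iterPartialDeriv_cons]
      simp only [Zcoef] at step ⊢
      rw [step]
      simp only [GG, List.map_append, List.sum_append, List.map_ofFn, List.sum_ofFn, Function.comp_def,
        eval_two, primFields_rho, primFields_vel, primFields_theta, iterPartialDeriv_cons, List.map_cons,
        List.map_nil, List.sum_cons, List.sum_nil]
      simp only [neg_one_mul, Finset.sum_neg_distrib]
      ring

/-- **The differentiated temperature equation**: along a primitive solution on `[a, b]`,
`∂ₜϑ_w + Σᵢ uᵢ∂ᵢϑ_w + D div u_w = Σ_{T ∈ HH ζ w} T(ρ, ϑ, u)` for every word `w`.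
[cite: Majda1984, Ch. 2 §2.1 Thm 2.2] -/
theorem temperature_word (hζ : ContDiff ℝ ∞ ζ) (hab : a < b)
    (h : IsPrimitiveEulerSolutionOn (EulerEOS.monatomicExcess ζ f) (Icc a b) ρ u ϑ) :
    ∀ (w : List (Fin 3)) {t : ℝ} (_ : t ∈ Icc a b) (x : 𝕋³),
      timeDerivWithin (Icc a b) (fun s => iterPartialDeriv w (ϑ s)) t x +
          (∑ i, u t x i * partialDeriv i (iterPartialDeriv w (ϑ t)) x) +
          ∑ k, Dcoef ζ (ρ t x) (ϑ t x) * partialDeriv k (iterPartialDeriv w (fun y => u t y k)) x =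
        ((HH ζ w).map fun T => T.eval (primFields ρ u ϑ t) PIdx.rho PIdx.theta x).sum
  | [], t, ht, x => by
      have := h.temperature_eq (uniqueDiffOn_Icc hab) ht x
      simp only [Torus.divergence, Finset.mul_sum] at this
      simpa [HH, Dcoef, Finset.mul_sum] using this
  | j :: w, t, ht, x => by
      have hS : UniqueDiffOn ℝ (Icc a b) := uniqueDiffOn_Icc hab
      have hφs : ∀ k, IsSmooth (primFields ρ u ϑ t k) := isSmooth_primFields h ht
      have hφq := primFields_mem_quadrant h ht
      have hρ1 : IsContDiff 1 (ρ t) := (hφs PIdx.rho).isContDiff (by simp)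
      have hϑ1 : IsContDiff 1 (ϑ t) := (hφs PIdx.theta).isContDiff (by simp)
      have hYs : IsSmoothSpaceTimeOn (Icc a b) fun s => iterPartialDeriv w (ϑ s) :=
        h.smooth_temperature.iterPartialDeriv hS w
      have hUs : ∀ k : Fin 3, IsSmooth (iterPartialDeriv w fun y => u t y k) := fun k =>
        ((h.smooth_velocity.apply k).iterPartialDeriv hS w).isSmooth_slice ht
      have hcD : IsSmooth fun y => Dcoef ζ (ρ t y) (ϑ t y) :=
        isSmooth_coeffField (a := PIdx.rho) (b := PIdx.theta) hφs (contDiffOn_Dcoef hζ) hφq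
      have hcoef : ∀ T ∈ HH ζ w, ContDiffOn ℝ ∞ (uncurry T.coeff) quadrant := fun T hT =>
        (mem_HH hζ w hT).2.2.2.2.2
      have hE : IsSmooth fun y => ((HH ζ w).map fun T => T.eval (primFields ρ u ϑ t) PIdx.rho PIdx.theta y).sum :=
        isSmooth_list_sum _ fun T hT => isSmooth_eval hφs (hcoef T hT) hφq
      have hdE : ∀ y, partialDeriv j
          (fun y => ((HH ζ w).map fun T => T.eval (primFields ρ u ϑ t) PIdx.rho PIdx.theta y).sum) y =
          (((HH ζ w).flatMap (dExp PIdx.rho PIdx.theta j)).map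
            fun T => T.eval (primFields ρ u ϑ t) PIdx.rho PIdx.theta y).sum := by
        intro y
        rw [partialDeriv_list_sum _ (fun T hT => isSmooth_eval hφs (hcoef T hT) hφq), List.map_flatMap,
          sum_flatMap_eq]
        congr 1
        exact List.map_congr_left fun T hT => partialDeriv_eval hφs isOpen_quadrant (hcoef T hT) hφq j y
      have step := word_step hS ht j x (uu := fun i y => u t y i) (fun i => hφs (PIdx.vel i)) hYs
        (c := fun _ y => Dcoef ζ (ρ t y) (ϑ t y)) (fun _ => hcD) (fun k => k)
        (Z := fun k => iterPartialDeriv w fun y => u t y k) hUs hE hdE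
        (fun y => temperature_word hζ hab h w ht y)
        (timeDerivWithin_partialDeriv_comm hab hYs ht j x)
      have hdD : partialDeriv j (fun y => Dcoef ζ (ρ t y) (ϑ t y)) x =
          dR (Dcoef ζ) (ρ t x) (ϑ t x) * partialDeriv j (ρ t) x +
            dT (Dcoef ζ) (ρ t x) (ϑ t x) * partialDeriv j (ϑ t) x :=
        partialDeriv_comp₂ (contDiffOn_Dcoef hζ) isOpen_quadrant (by simp) hρ1 hϑ1 x (hφq x) j
      rw [hdD] at step
      simp only [iterPartialDeriv_cons]
      rw [step]
      simp only [HH, List.map_append, List.sum_append, List.map_ofFn, List.sum_ofFn, Function.comp_def,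
        eval_two, primFields_rho, primFields_vel, primFields_theta, iterPartialDeriv_cons]
      simp only [neg_one_mul, Finset.sum_neg_distrib, add_mul, Finset.sum_add_distrib]
      simp only [mul_assoc, ← Finset.mul_sum]
      ring

end Identification

end CompressibleEuler

end Literature.Analysis.FluidPDE

end
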